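import Mathlib
import HarnessLib
import Summits.NavierStokesRegularity.NavierStokesRegularity.Theorems.PoloidalWindowDoorPoloidalWindowRigidityUntwistedDynamics
import Summits.NavierStokesRegularity.NavierStokesRegularity.Theorems.PoloidalWindowDoorPoloidalWindowRigidityUntwistedLeafRegularity

/-!
# Route `PoloidalWindowDoor`, crux `PoloidalWindowRigidity` (K2, stmt-NavierStokesRegularity-19708), skeleton `lrc-jet` v5,
# stub `stub_untwisted` — brick F2d: THE NS₃ NORMAL FORM WITH ANALYTIC STRUCTURE FUNCTIONS
# (the hypothesis list of the K2 lead's assembly core `untwisted_regular_of_normalForm`, produced from the stub's data)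

Cell ns-regularity-ideate, seat ns-poloidal-K2-p2 (gen 5; stub-worker under the K2 lead ns-poloidal-K2-p1 g6; `--supports stmt-NavierStokesRegularity-19708`
helper; brick F2 of `BRIEF-v5-bricks-v2.md` (S5), contract fixed by the lead's STATUS line 2026-08-27T18:36Z).  Fourth file of F2, after
`…StructureFunctionDynamics` (F2a), `…StructureFunctionNormalForm` (F2b) and `…UntwistedDynamics` (F2c: `untwisted_normalForm`, `Cⁿ` structure
functions).  The lead's Branch-2a Cramer quotient and the F4 Stuart-column argument differentiate the structure functions arbitrarily often along vertical
lines, so the contract asks for `P, Λ, k, pₜ` ANALYTIC at the leaf points.  This is obtained a posteriori, with no new analysis of the Clebsch pair: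
by ns-poloidal-K2-p3's `…UntwistedLeafRegularity.contDiffAt_leafFn_of_comp` (`n = ω`: a leafwise structure function is as smooth as the function it
represents, the leaf map `y ↦ (w y, y₂)` being a submersion where `∇ₕw ≠ 0`) applied to the four identities of F2c —
`P∘leaf = ∂₂w`, `Λ∘leaf = ∂₂v_b/∂_bw` (where `∂_bw ≠ 0`), `k∘leaf = (1−Λ)S − (1−Λ)M + Λ_wE` (from (V0)), `pₜ∘leaf = ∂₂S − P_wS − ΛE` (from (Sz)) —
whose right-hand sides are analytic in `y` (analytic slices `…Ancient.analyticOnNhd_slice`, analytic `∂ₜv₂(t,·)` from the joint analyticity on the slab).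

* `analyticAt_leaf_comp`, `analyticAt_dirPartial`, `analyticAt_fderiv_dir` — analyticity bookkeeping.
* `analyticAt_slice_coord`, `analyticAt_slice_fderiv_apply`, `analyticAt_timeDeriv_vert` — the slice quantities `vᵢ(t,·)`, `(Dv(t,·)e)ᵢ` and
  `∂ₜv₂(t,·)` (two-sided, `t < 0`) of a class profile are real-analytic on `ℝ³`.
* `untwisted_normalForm_analytic` — **BRICK F2, FINAL FORM.**  From EXACTLY the data of `stub_untwisted` (class + poloidal; open `W` of the slab, non-degenerate
  and untwisted) and `(t, y₀) ∈ W`: an open `U ∋ y₀` of the slice `t` inside `W` and `P, Λ, k, pₜ : ℝ × ℝ → ℝ` ANALYTIC at the leaf points `(w y, y₂)`, `y ∈ U`,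
  with, on `U` (`w = v₂(t,·)`, `E = (∂₀w)² + (∂₁w)²`, `M = ∂₀∂₀w + ∂₁∂₁w`, `S = v₀∂₀w + v₁∂₁w + ∂ₜw` differentiable): `∂₂w = P(w,y₂)`; `∇ₕw ≠ 0`;
  `Λ ≠ 0`; `Λ ≠ 1`; `∂₂v_b = Λ(w,y₂)∂_bw`; (K1) `Λ·M + Λ_w·E + DP(P,1) = 0`; (V0) `(1−Λ)·S = (1−Λ)·M − Λ_w·E + k`; (Sz) `∂₂S = P_w·S + Λ·E + pₜ` —
  i.e. `stub_untwisted` ⇐ this theorem + the lead's `untwisted_regular_of_normalForm` (pick any `(t,y₀) ∈ W`).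

WHAT THIS IS NOT: not a claim about Navier–Stokes regularity and not the stub — its analytic normal form (bears_on LADDER-NS N0 via crux K2 = stmt-19708).
-/

noncomputable section

-- the summit and its single sub-problem share the name (CONVENTIONS §1), as in every Theorems file
set_option linter.dupNamespace false

namespace Summit.NavierStokesRegularity.NavierStokesRegularity.Theorems.PoloidalWindowDoorPoloidalWindowRigidityUntwistedDynamicsAnalytic

open Set Function Filter Topology Metric
open scoped RealInnerProductSpace InnerProductSpace Laplacian ContDiff
open Literature.Analysis Literature.Analysis.FluidPDE Literature.Analysis.Calculus
open Summit.NavierStokesRegularity.NavierStokesRegularity.Theorems.LocalSineTubeDoorProfileAlignedWindowRigidityAncient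
open Summit.NavierStokesRegularity.NavierStokesRegularity.Theorems.PoloidalWindowDoorPoloidalWindowRigidityClebsch
open Summit.NavierStokesRegularity.NavierStokesRegularity.Theorems.PoloidalWindowDoorPoloidalWindowRigidityConstantShearMeans
open Summit.NavierStokesRegularity.NavierStokesRegularity.Theorems.PoloidalWindowDoorPoloidalWindowRigidityUntwistedSeparation
open Summit.NavierStokesRegularity.NavierStokesRegularity.Theorems.PoloidalWindowDoorPoloidalWindowRigidityUntwistedLeafRegularity
open Summit.NavierStokesRegularity.NavierStokesRegularity.Theorems.PoloidalWindowDoorPoloidalWindowRigidityStructureFunctionDynamics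
open Summit.NavierStokesRegularity.NavierStokesRegularity.Theorems.PoloidalWindowDoorPoloidalWindowRigidityStructureFunctionNormalForm
open Summit.NavierStokesRegularity.NavierStokesRegularity.Theorems.PoloidalWindowDoorPoloidalWindowRigidityUntwistedDynamics

/-! ### Analyticity of leaf compositions and of partials -/

/-- A leaf composition `y ↦ a(w y, y₂)` is analytic at `y` when `w` is analytic at `y` and `a` is analytic at the leaf point. [folklore] -/
theorem analyticAt_leaf_comp {w : EuclideanSpace ℝ (Fin 3) → ℝ} {a : ℝ × ℝ → ℝ} {y : EuclideanSpace ℝ (Fin 3)}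
    (hw : AnalyticAt ℝ w y) (ha : AnalyticAt ℝ a (w y, y 2)) : AnalyticAt ℝ (fun x => a (w x, x 2)) y :=
  ha.comp₂ hw ((EuclideanSpace.proj (𝕜 := ℝ) (2 : Fin 3)).analyticAt y)

/-- A directional partial `q ↦ Da(q) u` of a function analytic at `p` is analytic at `p`. [folklore] -/
theorem analyticAt_dirPartial {a : ℝ × ℝ → ℝ} {p : ℝ × ℝ} (ha : AnalyticAt ℝ a p) (u : ℝ × ℝ) :
    AnalyticAt ℝ (fun q => fderiv ℝ a q u) p :=
  ((ContinuousLinearMap.apply ℝ ℝ u).analyticAt _).comp ha.fderiv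

/-- A directional partial `x ↦ Df(x) e` of a scalar function analytic at `y ∈ ℝ³` is analytic at `y`. [folklore] -/
theorem analyticAt_fderiv_dir {f : EuclideanSpace ℝ (Fin 3) → ℝ} {y : EuclideanSpace ℝ (Fin 3)} (hf : AnalyticAt ℝ f y) (e : EuclideanSpace ℝ (Fin 3)) :
    AnalyticAt ℝ (fun x => fderiv ℝ f x e) y :=
  ((ContinuousLinearMap.apply ℝ ℝ e).analyticAt _).comp hf.fderiv

section Profile

variable {C : ℝ} {v : ℝ → EuclideanSpace ℝ (Fin 3) → EuclideanSpace ℝ (Fin 3)}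

/-! ### Analyticity of the slice quantities of a class profile -/

/-- The coordinate functions `x ↦ vᵢ(t, x)` of a slice are analytic. [folklore] -/
theorem analyticAt_slice_coord (hrate : HasTypeITimeDecay C v)
    (hcont : ContinuousOn (uncurry v) (Iio (0 : ℝ) ×ˢ univ))
    (hmild : ∀ s t : ℝ, s < t → t < 0 → ∀ x,
      v t x = UnboundedOperators.heatExtension (v s) (t - s) x - oseenDuhamel 1 s v v t x)
    {t : ℝ} (ht : t < 0) (i : Fin 3) (y : EuclideanSpace ℝ (Fin 3)) : AnalyticAt ℝ (fun x => v t x i) y :=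
  ((EuclideanSpace.proj (𝕜 := ℝ) i).analyticAt _).comp (analyticOnNhd_slice hcont (bdd_of_hasTypeITimeDecay hrate) hmild ht y (mem_univ _))

/-- The Jacobian entries `x ↦ (Dv(t,x) e)ᵢ` of a slice are analytic. [folklore] -/
theorem analyticAt_slice_fderiv_apply (hrate : HasTypeITimeDecay C v)
    (hcont : ContinuousOn (uncurry v) (Iio (0 : ℝ) ×ˢ univ))
    (hmild : ∀ s t : ℝ, s < t → t < 0 → ∀ x,
      v t x = UnboundedOperators.heatExtension (v s) (t - s) x - oseenDuhamel 1 s v v t x)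
    {t : ℝ} (ht : t < 0) (e : EuclideanSpace ℝ (Fin 3)) (i : Fin 3) (y : EuclideanSpace ℝ (Fin 3)) :
    AnalyticAt ℝ (fun x => fderiv ℝ (v t) x e i) y := by
  have h1 : AnalyticAt ℝ (fderiv ℝ (v t)) y := (analyticOnNhd_slice hcont (bdd_of_hasTypeITimeDecay hrate) hmild ht y (mem_univ _)).fderiv
  have h2 : AnalyticAt ℝ (fun x => fderiv ℝ (v t) x e) y :=
    ((ContinuousLinearMap.apply ℝ (EuclideanSpace ℝ (Fin 3)) e).analyticAt _).comp h1
  exact ((EuclideanSpace.proj (𝕜 := ℝ) i).analyticAt _).comp h2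

/-- The time derivative of the vertical velocity, `x ↦ ∂ₜv₂(t, x)` (two-sided, `t < 0`), is analytic. [folklore] -/
theorem analyticAt_timeDeriv_vert (hrate : HasTypeITimeDecay C v)
    (hcont : ContinuousOn (uncurry v) (Iio (0 : ℝ) ×ˢ univ))
    (hmild : ∀ s t : ℝ, s < t → t < 0 → ∀ x,
      v t x = UnboundedOperators.heatExtension (v s) (t - s) x - oseenDuhamel 1 s v v t x)
    {t : ℝ} (ht : t < 0) (y : EuclideanSpace ℝ (Fin 3)) : AnalyticAt ℝ (fun x => deriv (fun τ => v τ x 2) t) y := by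
  have hanV := analyticOnNhd_uncurry hcont (bdd_of_hasTypeITimeDecay hrate) hmild
  have hmem : ∀ x : EuclideanSpace ℝ (Fin 3), ((t, x) : ℝ × EuclideanSpace ℝ (Fin 3)) ∈ Iio (0 : ℝ) ×ˢ (univ : Set (EuclideanSpace ℝ (Fin 3))) :=
    fun x => mk_mem_prod ht (mem_univ _)
  -- `∂ₜv₂(t,x) = (D(uncurry v)(t,x)(1,0))₂`
  have e : (fun x : EuclideanSpace ℝ (Fin 3) => deriv (fun τ => v τ x 2) t) =
      fun x => (fderiv ℝ (uncurry v) (t, x) ((1 : ℝ), (0 : EuclideanSpace ℝ (Fin 3)))) 2 := by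
    funext x
    have hd : HasFDerivAt (uncurry v) (fderiv ℝ (uncurry v) (t, x)) (t, x) := (hanV _ (hmem x)).differentiableAt.hasFDerivAt
    have hline : HasDerivAt (fun τ : ℝ => ((τ, x) : ℝ × EuclideanSpace ℝ (Fin 3))) ((1 : ℝ), (0 : EuclideanSpace ℝ (Fin 3))) t :=
      (hasDerivAt_id t).prodMk (hasDerivAt_const t x)
    have hc := hd.comp_hasDerivAt t hline
    have hc2 := ((EuclideanSpace.proj (𝕜 := ℝ) (2 : Fin 3)).hasFDerivAt).comp_hasDerivAt t hc
    have e1 : (fun τ => v τ x 2) = (EuclideanSpace.proj (𝕜 := ℝ) (2 : Fin 3)) ∘ (uncurry v ∘ fun τ : ℝ => ((τ, x) : ℝ × EuclideanSpace ℝ (Fin 3))) := by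
      funext τ; rfl
    rw [e1, hc2.deriv]
    rfl
  rw [e]
  have h1 : AnalyticAt ℝ (fun x : EuclideanSpace ℝ (Fin 3) => fderiv ℝ (uncurry v) (t, x)) y :=
    (hanV _ (hmem y)).fderiv.comp₂ analyticAt_const analyticAt_id
  have h2 : AnalyticAt ℝ (fun x : EuclideanSpace ℝ (Fin 3) => fderiv ℝ (uncurry v) (t, x) ((1 : ℝ), (0 : EuclideanSpace ℝ (Fin 3)))) y :=
    ((ContinuousLinearMap.apply ℝ (EuclideanSpace ℝ (Fin 3)) ((1 : ℝ), (0 : EuclideanSpace ℝ (Fin 3)))).analyticAt _).comp h1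
  exact ((EuclideanSpace.proj (𝕜 := ℝ) (2 : Fin 3)).analyticAt _).comp h2


/-! ### The normal form with analytic structure functions -/

/-- **BRICK F2, FINAL FORM — the NS₃ normal form of an untwisted non-degenerate class germ with ANALYTIC structure functions.**  From EXACTLY the data
of the registered stub `stub_untwisted` (a profile of the route's Type-I class, poloidal along `e₃`; an open `W` of the backward slab on which the profile
is non-degenerate and the twist bracket vanishes) and a point `(t, y₀) ∈ W`: there are an open `U ∋ y₀` of the slice `t` inside `W` and structure
functions `P, Λ, k, pₜ : ℝ × ℝ → ℝ`, ANALYTIC at every leaf point `(w y, y₂)`, `y ∈ U` (`w = v₂(t,·)`), such that on `U` — with `E = (∂₀w)² + (∂₁w)²`,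
`M = ∂₀∂₀w + ∂₁∂₁w` and the (differentiable) scalar `S = v₀∂₀w + v₁∂₁w + ∂ₜw` —:  `∂₂w = P(w,y₂)`;  `∇ₕw ≠ 0`;  `Λ ≠ 0`, `Λ ≠ 1`;
`∂₂v_b = Λ(w,y₂)∂_bw` (`b = 0,1`);  (K1) `Λ·M + Λ_w·E + DP(P,1) = 0`;  (V0) `(1−Λ)·S = (1−Λ)·M − Λ_w·E + k`;  (Sz) `∂₂S = P_w·S + Λ·E + pₜ`
— the hypothesis list of the K2 lead's assembly core `untwisted_regular_of_normalForm` (HOME/ns-poloidal-K2-p1/g6/UntwistedAssemblyCore.lean).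
Analyticity is obtained a posteriori from `…UntwistedDynamics.untwisted_normalForm` by ns-poloidal-K2-p3's `contDiffAt_leafFn_of_comp` (`n = ω`):
`P∘leaf = ∂₂w`, `Λ∘leaf = ∂₂v_b/∂_bw`, `k∘leaf = (1−Λ)S − (1−Λ)M + Λ_wE`, `pₜ∘leaf = ∂₂S − P_wS − ΛE` are analytic in `y` (analytic slice, analytic
`∂ₜv₂(t,·)`, analytic leaf map). -/
theorem untwisted_normalForm_analytic (hrate : HasTypeITimeDecay C v)
    (hcont : ContinuousOn (uncurry v) (Iio (0 : ℝ) ×ˢ univ))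
    (hmild : ∀ s t : ℝ, s < t → t < 0 → ∀ x,
      v t x = UnboundedOperators.heatExtension (v s) (t - s) x - oseenDuhamel 1 s v v t x)
    (hdiv : ∀ t < 0, VectorCalculus.IsDivFree (v t))
    (hpol : ∀ s < 0, ∀ y, ⟪curl (v s) y, EuclideanSpace.single 2 1⟫_ℝ = 0)
    {W : Set (ℝ × EuclideanSpace ℝ (Fin 3))} (hW : IsOpen W) (hWs : W ⊆ Iio (0 : ℝ) ×ˢ univ)
    (hND : ∀ z ∈ W, curl (v z.1) z.2 ≠ 0 ∧
      (fderiv ℝ (v z.1) z.2 (EuclideanSpace.single 0 1) 2 ≠ 0 ∨ fderiv ℝ (v z.1) z.2 (EuclideanSpace.single 1 1) 2 ≠ 0) ∧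
      (fderiv ℝ (v z.1) z.2 (EuclideanSpace.single 2 1) 0 ≠ 0 ∨ fderiv ℝ (v z.1) z.2 (EuclideanSpace.single 2 1) 1 ≠ 0))
    (htw : ∀ z ∈ W,
      fderiv ℝ (fun x => fderiv ℝ (v z.1) x (EuclideanSpace.single 2 1) 2) z.2 (EuclideanSpace.single 0 1) *
          fderiv ℝ (v z.1) z.2 (EuclideanSpace.single 1 1) 2 -
        fderiv ℝ (fun x => fderiv ℝ (v z.1) x (EuclideanSpace.single 2 1) 2) z.2 (EuclideanSpace.single 1 1) *
          fderiv ℝ (v z.1) z.2 (EuclideanSpace.single 0 1) 2 = 0)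
    {t : ℝ} {y₀ : EuclideanSpace ℝ (Fin 3)} (hty₀ : (t, y₀) ∈ W) :
    ∃ U : Set (EuclideanSpace ℝ (Fin 3)), IsOpen U ∧ y₀ ∈ U ∧ (∀ y ∈ U, (t, y) ∈ W) ∧
    ∃ P Λ k pt : ℝ × ℝ → ℝ,
      (∀ y ∈ U, AnalyticAt ℝ P (v t y 2, y 2)) ∧ (∀ y ∈ U, AnalyticAt ℝ Λ (v t y 2, y 2)) ∧
      (∀ y ∈ U, AnalyticAt ℝ k (v t y 2, y 2)) ∧ (∀ y ∈ U, AnalyticAt ℝ pt (v t y 2, y 2)) ∧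
      (∀ y ∈ U, DifferentiableAt ℝ (fun y' => v t y' 0 * fderiv ℝ (fun x => v t x 2) y' (EuclideanSpace.single 0 (1 : ℝ)) +
        v t y' 1 * fderiv ℝ (fun x => v t x 2) y' (EuclideanSpace.single 1 (1 : ℝ)) + deriv (fun τ' => v τ' y' 2) t) y) ∧
      (∀ y ∈ U, fderiv ℝ (fun x => v t x 2) y (EuclideanSpace.single 2 (1 : ℝ)) = P (v t y 2, y 2)) ∧
      (∀ y ∈ U, fderiv ℝ (fun x => v t x 2) y (EuclideanSpace.single 0 (1 : ℝ)) ≠ 0 ∨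
        fderiv ℝ (fun x => v t x 2) y (EuclideanSpace.single 1 (1 : ℝ)) ≠ 0) ∧
      (∀ y ∈ U, Λ (v t y 2, y 2) ≠ 0) ∧ (∀ y ∈ U, Λ (v t y 2, y 2) ≠ 1) ∧
      (∀ y ∈ U, ∀ b : Fin 3, b ≠ 2 →
        fderiv ℝ (v t) y (EuclideanSpace.single 2 1) b = Λ (v t y 2, y 2) * fderiv ℝ (fun x => v t x 2) y (EuclideanSpace.single b (1 : ℝ))) ∧
      (∀ y ∈ U,
        Λ (v t y 2, y 2) *
            (fderiv ℝ (fun y' => fderiv ℝ (fun x => v t x 2) y' (EuclideanSpace.single 0 (1 : ℝ))) y (EuclideanSpace.single 0 (1 : ℝ)) +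
              fderiv ℝ (fun y' => fderiv ℝ (fun x => v t x 2) y' (EuclideanSpace.single 1 (1 : ℝ))) y (EuclideanSpace.single 1 (1 : ℝ))) +
          fderiv ℝ Λ (v t y 2, y 2) (1, 0) *
            (fderiv ℝ (fun x => v t x 2) y (EuclideanSpace.single 0 (1 : ℝ)) ^ 2 + fderiv ℝ (fun x => v t x 2) y (EuclideanSpace.single 1 (1 : ℝ)) ^ 2) +
          fderiv ℝ P (v t y 2, y 2) (P (v t y 2, y 2), 1) = 0) ∧
      (∀ y ∈ U,
        (1 - Λ (v t y 2, y 2)) *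
            (v t y 0 * fderiv ℝ (fun x => v t x 2) y (EuclideanSpace.single 0 (1 : ℝ)) +
              v t y 1 * fderiv ℝ (fun x => v t x 2) y (EuclideanSpace.single 1 (1 : ℝ)) + deriv (fun τ' => v τ' y 2) t) =
          (1 - Λ (v t y 2, y 2)) *
              (fderiv ℝ (fun y' => fderiv ℝ (fun x => v t x 2) y' (EuclideanSpace.single 0 (1 : ℝ))) y (EuclideanSpace.single 0 (1 : ℝ)) +
                fderiv ℝ (fun y' => fderiv ℝ (fun x => v t x 2) y' (EuclideanSpace.single 1 (1 : ℝ))) y (EuclideanSpace.single 1 (1 : ℝ))) -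
            fderiv ℝ Λ (v t y 2, y 2) (1, 0) *
              (fderiv ℝ (fun x => v t x 2) y (EuclideanSpace.single 0 (1 : ℝ)) ^ 2 + fderiv ℝ (fun x => v t x 2) y (EuclideanSpace.single 1 (1 : ℝ)) ^ 2) +
            k (v t y 2, y 2)) ∧
      (∀ y ∈ U,
        fderiv ℝ (fun y' => v t y' 0 * fderiv ℝ (fun x => v t x 2) y' (EuclideanSpace.single 0 (1 : ℝ)) +
            v t y' 1 * fderiv ℝ (fun x => v t x 2) y' (EuclideanSpace.single 1 (1 : ℝ)) + deriv (fun τ' => v τ' y' 2) t) y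
            (EuclideanSpace.single 2 (1 : ℝ)) =
          fderiv ℝ P (v t y 2, y 2) (1, 0) *
              (v t y 0 * fderiv ℝ (fun x => v t x 2) y (EuclideanSpace.single 0 (1 : ℝ)) +
                v t y 1 * fderiv ℝ (fun x => v t x 2) y (EuclideanSpace.single 1 (1 : ℝ)) + deriv (fun τ' => v τ' y 2) t) +
            Λ (v t y 2, y 2) *
              (fderiv ℝ (fun x => v t x 2) y (EuclideanSpace.single 0 (1 : ℝ)) ^ 2 + fderiv ℝ (fun x => v t x 2) y (EuclideanSpace.single 1 (1 : ℝ)) ^ 2) +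
            pt (v t y 2, y 2)) := by
  have ht : t < 0 := (mem_prod.1 (hWs hty₀)).1
  obtain ⟨U, hUo, hy₀U, hUW, P, Λ, c, k, pt, hreg, hpins, hP, hΛ, -, hV0, hSz⟩ :=
    untwisted_normalForm 2 hrate hcont hmild hdiv hpol hW hWs hND htw hty₀
  have hV : ContDiff ℝ ∞ (v t) := contDiff_slice hrate hcont hmild ht
  have hVd : Differentiable ℝ (v t) := hV.differentiable (by simp)
  set w : EuclideanSpace ℝ (Fin 3) → ℝ := fun x => v t x 2 with hw
  -- analyticity of the slice quantities
  have hwA : ∀ y, AnalyticAt ℝ w y := fun y => analyticAt_slice_coord hrate hcont hmild ht 2 y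
  have hdwA : ∀ (e y : EuclideanSpace ℝ (Fin 3)), AnalyticAt ℝ (fun x => fderiv ℝ w x e) y := fun e y => analyticAt_fderiv_dir (hwA y) e
  have hddwA : ∀ (e e' y : EuclideanSpace ℝ (Fin 3)), AnalyticAt ℝ (fun x => fderiv ℝ (fun x' => fderiv ℝ w x' e) x e') y := fun e e' y =>
    analyticAt_fderiv_dir (hdwA e y) e'
  have hvA : ∀ (i : Fin 3) (y : EuclideanSpace ℝ (Fin 3)), AnalyticAt ℝ (fun x => v t x i) y := fun i y => analyticAt_slice_coord hrate hcont hmild ht i y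
  have hWtA : ∀ y, AnalyticAt ℝ (fun x => deriv (fun τ' => v τ' x 2) t) y := fun y => analyticAt_timeDeriv_vert hrate hcont hmild ht y
  set S : EuclideanSpace ℝ (Fin 3) → ℝ := fun y' => v t y' 0 * fderiv ℝ w y' (EuclideanSpace.single 0 (1 : ℝ)) +
    v t y' 1 * fderiv ℝ w y' (EuclideanSpace.single 1 (1 : ℝ)) + deriv (fun τ' => v τ' y' 2) t with hS
  have hSA : ∀ y, AnalyticAt ℝ S y := fun y =>
    (((hvA 0 y).mul (hdwA _ y)).add ((hvA 1 y).mul (hdwA _ y))).add (hWtA y)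
  set E : EuclideanSpace ℝ (Fin 3) → ℝ := fun y' => fderiv ℝ w y' (EuclideanSpace.single 0 (1 : ℝ)) ^ 2 + fderiv ℝ w y' (EuclideanSpace.single 1 (1 : ℝ)) ^ 2 with hE
  have hEA : ∀ y, AnalyticAt ℝ E y := fun y => ((hdwA _ y).pow 2).add ((hdwA _ y).pow 2)
  set M : EuclideanSpace ℝ (Fin 3) → ℝ := fun y' => fderiv ℝ (fun x' => fderiv ℝ w x' (EuclideanSpace.single 0 (1 : ℝ))) y' (EuclideanSpace.single 0 (1 : ℝ)) +
    fderiv ℝ (fun x' => fderiv ℝ w x' (EuclideanSpace.single 1 (1 : ℝ))) y' (EuclideanSpace.single 1 (1 : ℝ)) with hM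
  have hMA : ∀ y, AnalyticAt ℝ M y := fun y => (hddwA _ _ y).add (hddwA _ _ y)
  -- the horizontal pin on `U`
  have hnd : ∀ y ∈ U, fderiv ℝ w y (EuclideanSpace.single 0 (1 : ℝ)) ≠ 0 ∨ fderiv ℝ w y (EuclideanSpace.single 1 (1 : ℝ)) ≠ 0 := by
    intro y hy
    obtain ⟨-, hne, -⟩ := hND _ (hUW y hy)
    have hne' : fderiv ℝ (v t) y (EuclideanSpace.single 0 1) 2 ≠ 0 ∨ fderiv ℝ (v t) y (EuclideanSpace.single 1 1) 2 ≠ 0 := hne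
    rw [← fderiv_coord_apply (hVd y) 2, ← fderiv_coord_apply (hVd y) 2] at hne'
    exact hne'
  -- ## analyticity of `P`: `P∘leaf = ∂₂w`
  have hPA : ∀ y ∈ U, AnalyticAt ℝ P (v t y 2, y 2) := by
    intro y hy
    refine (contDiffAt_leafFn_of_comp (n := ω) (by simp) (a := P) (hwA y).contDiffAt (hdwA (EuclideanSpace.single 2 (1 : ℝ)) y).contDiffAt
      (hnd y hy) ?_).analyticAt
    filter_upwards [hUo.mem_nhds hy] with y' hy' using hP y' hy'
  -- ## analyticity of `Λ`: `Λ∘leaf = ∂₂v_b / ∂_b w` near a point with `∂_b w ≠ 0`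
  have hΛA : ∀ y ∈ U, AnalyticAt ℝ Λ (v t y 2, y 2) := by
    intro y hy
    obtain ⟨b, hb, hb0⟩ : ∃ b : Fin 3, b ≠ 2 ∧ fderiv ℝ w y (EuclideanSpace.single b (1 : ℝ)) ≠ 0 := by
      rcases hnd y hy with h | h
      · exact ⟨0, by decide, h⟩
      · exact ⟨1, by decide, h⟩
    have hnum : AnalyticAt ℝ (fun x => fderiv ℝ (v t) x (EuclideanSpace.single 2 1) b) y := analyticAt_slice_fderiv_apply hrate hcont hmild ht _ b y
    have hq : AnalyticAt ℝ (fun x => fderiv ℝ (v t) x (EuclideanSpace.single 2 1) b / fderiv ℝ w x (EuclideanSpace.single b (1 : ℝ))) y :=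
      hnum.div (hdwA _ y) hb0
    refine (contDiffAt_leafFn_of_comp (n := ω) (by simp) (a := Λ) (hwA y).contDiffAt hq.contDiffAt (hnd y hy) ?_).analyticAt
    have hne0 : ∀ᶠ y' in 𝓝 y, fderiv ℝ w y' (EuclideanSpace.single b (1 : ℝ)) ≠ 0 := (hdwA _ y).continuousAt.eventually_ne hb0
    filter_upwards [hUo.mem_nhds hy, hne0] with y' hy' hy'0
    rw [hΛ y' hy' b hb, mul_div_assoc, div_self hy'0, mul_one]
  -- ## analyticity of `k`: `k∘leaf = (1−Λ)S − (1−Λ)M + Λ_w E`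
  have hkA : ∀ y ∈ U, AnalyticAt ℝ k (v t y 2, y 2) := by
    intro y hy
    have hL : AnalyticAt ℝ (fun x => Λ (w x, x 2)) y := analyticAt_leaf_comp (hwA y) (hΛA y hy)
    have hLw : AnalyticAt ℝ (fun x => fderiv ℝ Λ (w x, x 2) (1, 0)) y :=
      analyticAt_leaf_comp (a := fun q => fderiv ℝ Λ q (1, 0)) (hwA y) (analyticAt_dirPartial (hΛA y hy) _)
    have hg : AnalyticAt ℝ (fun x => (1 - Λ (w x, x 2)) * S x - ((1 - Λ (w x, x 2)) * M x - fderiv ℝ Λ (w x, x 2) (1, 0) * E x)) y :=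
      ((analyticAt_const.sub hL).mul (hSA y)).sub (((analyticAt_const.sub hL).mul (hMA y)).sub (hLw.mul (hEA y)))
    refine (contDiffAt_leafFn_of_comp (n := ω) (by simp) (a := k) (hwA y).contDiffAt hg.contDiffAt (hnd y hy) ?_).analyticAt
    filter_upwards [hUo.mem_nhds hy] with y' hy'
    have h := hV0 y' hy'
    simp only [hS, hM, hE] at h ⊢
    linarith
  -- ## analyticity of `pt`: `pt∘leaf = ∂₂S − P_w S − Λ E`
  have hptA : ∀ y ∈ U, AnalyticAt ℝ pt (v t y 2, y 2) := by
    intro y hy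
    have hL : AnalyticAt ℝ (fun x => Λ (w x, x 2)) y := analyticAt_leaf_comp (hwA y) (hΛA y hy)
    have hPw : AnalyticAt ℝ (fun x => fderiv ℝ P (w x, x 2) (1, 0)) y :=
      analyticAt_leaf_comp (a := fun q => fderiv ℝ P q (1, 0)) (hwA y) (analyticAt_dirPartial (hPA y hy) _)
    have hSz' : AnalyticAt ℝ (fun x => fderiv ℝ S x (EuclideanSpace.single 2 (1 : ℝ))) y := analyticAt_fderiv_dir (hSA y) _
    have hg : AnalyticAt ℝ (fun x => fderiv ℝ S x (EuclideanSpace.single 2 (1 : ℝ)) - fderiv ℝ P (w x, x 2) (1, 0) * S x - Λ (w x, x 2) * E x) y :=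
      (hSz'.sub (hPw.mul (hSA y))).sub (hL.mul (hEA y))
    refine (contDiffAt_leafFn_of_comp (n := ω) (by simp) (a := pt) (hwA y).contDiffAt hg.contDiffAt (hnd y hy) ?_).analyticAt
    filter_upwards [hUo.mem_nhds hy] with y' hy'
    have h := hSz y' hy'
    simp only [hS, hE] at h ⊢
    linarith
  -- ## (K1) with `c = DP(P,1)` inlined
  have hPd : ∀ y ∈ U, DifferentiableAt ℝ P (v t y 2, y 2) := fun y hy => (hPA y hy).differentiableAt
  have hΛd : ∀ y ∈ U, DifferentiableAt ℝ Λ (v t y 2, y 2) := fun y hy => (hΛA y hy).differentiableAt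
  have hK1 := fun y (hy : y ∈ U) =>
    divIdentity_of_structureFunctions (V := v t) (hV.of_le (by norm_cast)) (hdiv t ht) hUo hPd hΛd hP hΛ hy
  refine ⟨U, hUo, hy₀U, hUW, P, Λ, k, pt, hPA, hΛA, hkA, hptA, fun y _ => (hSA y).differentiableAt, hP, hnd,
    fun y hy => (hpins y hy).1, fun y hy => (hpins y hy).2, hΛ, hK1, hV0, hSz⟩
end Profile

end Summit.NavierStokesRegularity.NavierStokesRegularity.Theorems.PoloidalWindowDoorPoloidalWindowRigidityUntwistedDynamicsAnalytic

end
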